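import Literature.NumberTheory.LFunctions.Zhang2022.Section12Top1522Holds
import Literature.NumberTheory.LFunctions.Zhang2022.RepairGapSection12U020Premise
import Literature.NumberTheory.LFunctions.Zhang2022.RepairGapLemma84LeafUnconditional
import HarnessLib

/-!
# Zhang (2022), rescue GAP/BED (D-0124 (3)(4)): the §12 top-range evaluation node u049 (`Typed.Sec12C.Top1522Ex`, exact
# reading of (12.16)'s input) under the minimum premise `‖L(1,χ)‖ ≤ 𝓛⁻¹⁵` — UNCONDITIONAL

Topic `Literature/NumberTheory/LFunctions/Zhang2022` (Landau–Siegel audit tree; verdict-neutral).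
Y. Zhang, *Discrete mean estimates and the Landau–Siegel zero*, arXiv:2211.02515v1 (2022)
[Zhang2022LandauSiegel] — **an unrefereed manuscript under adjudication; nothing in this file asserts or
denies its Theorems 1–2, and nothing here is a claim about Landau–Siegel zeros. The programme SEARCHES and
TYPES; no claim about Landau–Siegel zeros, Theorems 1–2 of arXiv:2211.02515 or a repaired Margin232 until a
kernel theorem says so.**

The node `Typed.Sec12C.Top1522Ex c′` (Z22:§12.u049, p. 73: «the sum over `P″₁ < dr < P₂` [of `S_j(𝐚₁₅,𝐚₂₂)`] = … + o(α)»,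
exact reading RT-02/R-18; the binder `hTop1522` of `Sec12D.eval1217Rel_of_exact`) is a tree theorem (`top1522Ex_holds`)
through the edge `sjOn_top_a15_sum_of_rel` (file `Section12TopRangeA15`) over the Lemma 12.1 evaluation
`Typed.Sec12B.U020_holds`, the relative Lemma 8.4 (`Skeleton.Lemma84Rel`) and the guard-free tail mean, plus the guard-free
window / integral comparisons (`sumEx_sub_windows`, `main12u049sumEx_sub_intEx`). Both (A)-inputs are kernel at exponent 15:
`Typed.Sec12B.U020_pow15` (p590824) and `Skeleton.lemma84Rel_pow15` (p608375). This file re-runs the three edges VERBATIM with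
the guard text swapped:

* `sjOn_top_a15_sum_pow15` — the sum form of u049 under `‖L(1,χ)‖ ≤ 𝓛⁻¹⁵` (same constant `K`, same thresholds);
* `sjOn_top_a15_sub_sumEx_pow15` — moved to the printed windows;
* `top1522Ex_pow15` — **the body of the node `Top1522Ex c′` with guard `‖L(1,χ)‖ ≤ 𝓛⁻¹⁵`, every `c′`, UNCONDITIONAL**;
  `top1522Ex_of_assumptionAWith` — every real `E ≥ 15` (at `E = 2022` the body of the tree theorem `top1522Ex_holds`,
  not restated).

With `top1225Ex_pow15` (`RepairGapSection12Top1225Premise`): BOTH §12 top-range evaluation nodes of the (12.17) chain are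
kernel at (A)-exponent 15. NOT re-keyed here (honesty): (12.16) as printed (`Sec12D.eq1216_of_top1522Ex` also consumes the
low range `low1522_holds`, whose edge `low1522_of_lemma84Rel` pulls the Lemma 12.1 range file) and the other (12.17) inputs
(`Eq126`, `Eq128`, `Eq1212`, `Mid1225`, `Low1522`, `Win1217Ex`; and Part I). Theorems only; no definition, no named fact;
nothing about (A) itself.

## References

* Y. Zhang, arXiv:2211.02515v1 (2022), §12 p. 73 (u049, (12.16)); Lemma 12.1 p. 68; §8 Lemma 8.4.
  [cite: Zhang2022LandauSiegel, §12 (12.16) p.73]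
-/

noncomputable section

open Complex Real ComplexConjugate Finset
open Literature.NumberTheory.LFunctions.Zhang2022
open Literature.NumberTheory.LFunctions.Zhang2022.Skeleton
open Literature.NumberTheory.LFunctions.Zhang2022.Typed.Sec10C (nSum22 forAllLarge_five_c one_le_bigP norm_iota34_le)
open Literature.NumberTheory.LFunctions.Zhang2022.Typed.Sec10C.Ranges1422

namespace Literature.NumberTheory.LFunctions.Zhang2022.Typed.Sec12C

open TopRangeA15
open Literature.NumberTheory.LFunctions.Zhang2022.Repair.Bed (AssumptionAWith)

variable (c' : ℝ)

/-- **Z22:§12.u049 (sum form, exact reading) UNDER THE MINIMUM PREMISE** (twin of `sjOn_top_a15_sum_of_rel`, proof verbatim,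
inputs `Typed.Sec12B.U020_pow15` and `Skeleton.lemma84Rel_pow15`, guard `‖L(1,χ)‖ ≤ 𝓛⁻¹⁵`).
[cite: Zhang2022LandauSiegel, §12 p. 73 (tex L3694)] -/
theorem sjOn_top_a15_sum_pow15 :
    ∀ ε : ℝ, 0 < ε → ForAllLarge fun D _ χ => ‖χ.LFunction 1‖ ≤ 1 / Real.log D ^ 15 →
      ∀ a15 : ℕ → ℂ, (∀ n, a15 n = χ (n : ZMod D) * vk13 D n) →
        ∀ j ∈ ({1, 2, 3} : Finset ℕ),
          ‖SjOn c' D j a15 (a22 χ) (rngTop D) -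
              (deriv χ.LFunction 1 ^ 2 * iota3 / (0.504 * 0.498 * (Real.log (bigP D) : ℂ) ^ 2) *
                  ∑ n ∈ (Finset.Ico 1 (Nsupp D)).filter
                      (fun n : ℕ => P1pp D < n ∧ (n : ℝ) < Skeleton.P3 D),
                    (‖χ (n : ZMod D)‖ : ℂ) * lamZero c' D j n / (Nat.totient n : ℂ) *
                      (frakgW c' D j 6 (bigP D ^ (0.498 : ℝ) / n) *
                        ((((n : ℝ) / P1pp D : ℝ) : ℂ) ^ (-beta6 D) *
                          (-1 + (beta6 D - betaJ c' D j) * (Real.log ((n : ℝ) / P1pp D) : ℂ)))) +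
                deriv χ.LFunction 1 ^ 2 * iota4 / (0.504 * 0.5 * (Real.log (bigP D) : ℂ) ^ 2) *
                  ∑ n ∈ (Finset.Ico 1 (Nsupp D)).filter
                      (fun n : ℕ => P1pp D < n ∧ (n : ℝ) < Skeleton.P2 D),
                    (‖χ (n : ZMod D)‖ : ℂ) * lamZero c' D j n / (Nat.totient n : ℂ) *
                      (frakgW c' D j 7 (bigP D ^ (0.5 : ℝ) / n) *
                        ((((n : ℝ) / P1pp D : ℝ) : ℂ) ^ (-beta6 D) *
                          (-1 + (beta6 D - betaJ c' D j) * (Real.log ((n : ℝ) / P1pp D) : ℂ)))))‖ ≤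
            ε * alpha D := by
  classical
  intro ε hε
  obtain ⟨c, hc, C₁, H020⟩ := Typed.Sec12B.U020_pow15 c'
  obtain ⟨C₂, H84⟩ := Skeleton.lemma84Rel_pow15 c'
  obtain ⟨C₃, H3⟩ := XiZeroMajorant.xiZeroTailMean c'
  set K : ℝ := Real.exp 256 *
          ((28000 * Real.exp (9 / 2) + 2 * max C₁ 0 + 2000 * Real.exp (9 / 2) * (4 * π) * 520) * 9 *
              max C₂ 0 +
            (2 * max C₁ 0 + 2000 * Real.exp (9 / 2) * (4 * π) * 520) * (4 * Real.exp (9 / 2)) * 146 * 9 +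
            537 * (2 * max C₁ 0 + 28000 * Real.exp (9 / 2)) * 9 *
              (584 * Real.exp (9 / 2) + max C₂ 0 + 8 * max C₃ 0) +
            537 * (28000 * Real.exp (9 / 2)) * (4 * Real.exp (9 / 2)) * 146 * 9 +
            28000 * Real.exp (9 / 2) * (4 * Real.exp (9 / 2)) * 100000) with hK
  have hK0 : 0 ≤ K := by positivity
  have h2K0 : 0 ≤ 2 * K := by positivity
  set x : ℝ := max 4 (max (5 * |c'| * π) (max ((15 / c) ^ 10) ((2 * K) ^ 2 / (ε ^ 2 * π ^ 2))))
    with hx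
  have FL : ForAllLarge fun D _ _ => 4 ≤ ell D ∧ 5 * |c'| * π ≤ ell D ∧ (15 / c) ^ 10 ≤ ell D ∧
      (2 * K) ^ 2 / (ε ^ 2 * π ^ 2) ≤ ell D := by
    refine ForAllLarge.of_le ⌈Real.exp x⌉₊ fun D _ χ hD _ _ => ?_
    have hxℓ := le_ell_of_ceil_exp_le hD
    refine ⟨?_, ?_, ?_, ?_⟩ <;> refine le_trans ?_ hxℓ <;> simp [hx]
  refine (((H020.and H84).and H3).and FL).mono ?_
  intro D _ χ hq hp ⟨⟨⟨hA, hB⟩, hC⟩, h4, h5, h15, hKℓ⟩ hAss a15 ha15 j hj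
  have hℓ : 3 ≤ ell D := by linarith
  have hℓ1 : 1 ≤ ell D := by linarith
  have hℓ4' : 4 ≤ Real.log D := by simpa only [ell] using h4
  have hc5 := hc5_of_le c' hℓ h5
  have hTc := bigT_rpow_neg_le_fifteen hc hℓ1 h15
  have hP3P2 : Skeleton.P3 D ≤ Skeleton.P2 D := Sec12D.P3_le_P2 hℓ4'
  obtain ⟨-, -, hb5, h5504, -, -, -⟩ := range_facts (D := D) hℓ
  obtain ⟨-, -, hP2le, hP3def, -⟩ := window_facts (D := D) hℓ
  have h6 := six_at c' χ h4 hq hp hc5 hTc (hA hAss) (hB hAss) hC hj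
  have h7 := seven_at c' χ h4 hq hp hc5 hTc (hA hAss) (hB hAss) hC hj
  -- the two pieces of the range
  set S := (Finset.Ico 1 (Nsupp D)).filter
      (fun n : ℕ => P1pp D < n ∧ (n : ℝ) < Skeleton.P2 D) with hSdef
  set S₆ := (Finset.Ico 1 (Nsupp D)).filter
      (fun n : ℕ => P1pp D < n ∧ (n : ℝ) < Skeleton.P3 D) with hS₆def
  set S₇ := S.filter (fun n : ℕ => ¬ ((n : ℝ) < Skeleton.P3 D)) with hS₇def
  have hS6 : S.filter (fun n : ℕ => (n : ℝ) < Skeleton.P3 D) = S₆ := by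
    ext n
    simp only [hSdef, hS₆def, Finset.mem_filter]
    constructor
    · rintro ⟨⟨h1, h2, -⟩, h3⟩; exact ⟨h1, h2, h3⟩
    · rintro ⟨h1, h2, h3⟩; exact ⟨⟨h1, h2, lt_of_lt_of_le h3 hP3P2⟩, h3⟩
  -- the left side, split at `P₃` and re-indexed
  have hL6 : SjOn c' D j a15 (a22 χ) (fun k => rngTop D k ∧ (k : ℝ) < Skeleton.P3 D) =
      ∑ n ∈ S₆, ∑ r ∈ n.divisors,
        (if Squarefree r then
          (‖χ (n : ZMod D)‖ : ℂ) * lamZero c' D j n / (n : ℂ) / (Nat.totient r : ℂ) *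
            Typed.Sec12B.sum121 c' χ j n * nSum22 c' χ j (n / r) r else 0) := by
    rw [Sec12D.SjOn_congr c' j a15 (a22 χ) (R' := fun k : ℕ => P1pp D < k ∧ (k : ℝ) < Skeleton.P3 D)
      (fun k => ⟨fun h => ⟨h.1.1, h.2⟩, fun h => ⟨⟨h.1, lt_of_lt_of_le h.2 hP3P2⟩, h.2⟩⟩)]
    exact SjOn_a15_eq_divisor_sum c' χ hℓ hq j a15 ha15 _
      (fun n hn => by rw [hP3def] at hn; linarith [hn.2])
  have hL7 : SjOn c' D j a15 (a22 χ) (fun k => rngTop D k ∧ ¬ ((k : ℝ) < Skeleton.P3 D)) =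
      ∑ n ∈ S₇, ∑ r ∈ n.divisors,
        (if Squarefree r then
          (‖χ (n : ZMod D)‖ : ℂ) * lamZero c' D j n / (n : ℂ) / (Nat.totient r : ℂ) *
            Typed.Sec12B.sum121 c' χ j n * nSum22 c' χ j (n / r) r else 0) := by
    have hS7 : (Finset.Ico 1 (Nsupp D)).filter
        (fun n : ℕ => rngTop D n ∧ ¬ ((n : ℝ) < Skeleton.P3 D)) = S₇ := by
      ext n
      simp only [hS₇def, hSdef, Finset.mem_filter, rngTop, and_assoc]
    rw [← hS7]
    exact SjOn_a15_eq_divisor_sum c' χ hℓ hq j a15 ha15 _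
      (fun n hn => by have := hn.1.2; linarith)
  rw [← Sec12D.SjOn_split c' j a15 (a22 χ) (rngTop D) (fun k => (k : ℝ) < Skeleton.P3 D), hL6, hL7,
    ← Finset.sum_filter_add_sum_filter_not S (fun n : ℕ => (n : ℝ) < Skeleton.P3 D), hS6]
  -- bookkeeping
  set A₆ := ∑ n ∈ S₆, ∑ r ∈ n.divisors,
        (if Squarefree r then
          (‖χ (n : ZMod D)‖ : ℂ) * lamZero c' D j n / (n : ℂ) / (Nat.totient r : ℂ) *
            Typed.Sec12B.sum121 c' χ j n * nSum22 c' χ j (n / r) r else 0) with hA₆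
  set A₇ := ∑ n ∈ S₇, ∑ r ∈ n.divisors,
        (if Squarefree r then
          (‖χ (n : ZMod D)‖ : ℂ) * lamZero c' D j n / (n : ℂ) / (Nat.totient r : ℂ) *
            Typed.Sec12B.sum121 c' χ j n * nSum22 c' χ j (n / r) r else 0) with hA₇
  set T6 := ∑ n ∈ S₆, (‖χ (n : ZMod D)‖ : ℂ) * lamZero c' D j n / (Nat.totient n : ℂ) *
      (frakgW c' D j 6 (bigP D ^ (0.498 : ℝ) / n) *
        ((((n : ℝ) / P1pp D : ℝ) : ℂ) ^ (-beta6 D) *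
          (-1 + (beta6 D - betaJ c' D j) * (Real.log ((n : ℝ) / P1pp D) : ℂ)))) with hT6
  set T7a := ∑ n ∈ S₆, (‖χ (n : ZMod D)‖ : ℂ) * lamZero c' D j n / (Nat.totient n : ℂ) *
      (frakgW c' D j 7 (bigP D ^ (0.5 : ℝ) / n) *
        ((((n : ℝ) / P1pp D : ℝ) : ℂ) ^ (-beta6 D) *
          (-1 + (beta6 D - betaJ c' D j) * (Real.log ((n : ℝ) / P1pp D) : ℂ)))) with hT7a
  set T7b := ∑ n ∈ S₇, (‖χ (n : ZMod D)‖ : ℂ) * lamZero c' D j n / (Nat.totient n : ℂ) *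
      (frakgW c' D j 7 (bigP D ^ (0.5 : ℝ) / n) *
        ((((n : ℝ) / P1pp D : ℝ) : ℂ) ^ (-beta6 D) *
          (-1 + (beta6 D - betaJ c' D j) * (Real.log ((n : ℝ) / P1pp D) : ℂ)))) with hT7b
  set p6 := deriv χ.LFunction 1 ^ 2 * iota3 / (0.504 * 0.498 * (Real.log (bigP D) : ℂ) ^ 2) with hp6
  set p7 := deriv χ.LFunction 1 ^ 2 * iota4 / (0.504 * 0.5 * (Real.log (bigP D) : ℂ) ^ 2) with hp7
  have e : A₆ + A₇ - (p6 * T6 + p7 * (T7a + T7b)) = (A₆ - (p6 * T6 + p7 * T7a)) + (A₇ - p7 * T7b) := by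
    ring
  rw [e]
  refine (norm_add_le _ _).trans ((add_le_add h6 h7).trans ?_)
  have hfin := K_tau5_le_eps_alpha h2K0 hε hℓ hKℓ
  rw [hK] at hfin
  linarith [hfin]

/-- **The EVAL half of u049 in the typed currency UNDER THE MINIMUM PREMISE** (twin of `sjOn_top_a15_sub_sumEx`).
[cite: Zhang2022LandauSiegel, §12 (12.16) p.73] -/
theorem sjOn_top_a15_sub_sumEx_pow15 :
    ∀ ε : ℝ, 0 < ε → ForAllLarge fun D _ χ => ‖χ.LFunction 1‖ ≤ 1 / Real.log D ^ 15 →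
      ∀ a15 : ℕ → ℂ, (∀ n, a15 n = χ (n : ZMod D) * vk13 D n) →
        ∀ j ∈ ({1, 2, 3} : Finset ℕ),
          ‖SjOn c' D j a15 (a22 χ) (rngTop D) - main12u049sumEx c' χ j‖ ≤ ε * alpha D := by
  intro ε hε
  have hε2 : 0 < ε / 2 := by positivity
  refine ((sjOn_top_a15_sum_pow15 c' (ε / 2) hε2).and
    (sumEx_sub_windows c' (ε / 2) hε2)).mono ?_
  intro D _ χ _ _ ⟨hE, hB⟩ hA a15 ha15 j hj
  have h1 := hE hA a15 ha15 j hj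
  have h2 := hB j hj
  have h2' := norm_sub_rev (main12u049sumEx c' χ j) _ ▸ h2
  calc ‖SjOn c' D j a15 (a22 χ) (rngTop D) - main12u049sumEx c' χ j‖
      ≤ ‖SjOn c' D j a15 (a22 χ) (rngTop D) - _‖ + ‖_ - main12u049sumEx c' χ j‖ := norm_sub_le_norm_sub_add_norm_sub _ _ _
    _ ≤ ε / 2 * alpha D + ε / 2 * alpha D := add_le_add h1 h2'
    _ = ε * alpha D := by ring

/-- **`Z22:§12.u049` (exact reading) — node `Top1522Ex` — UNDER THE MINIMUM PREMISE, UNCONDITIONAL**: for every `ε > 0`, all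
large `D`, every real primitive `χ` with `‖L(1,χ)‖ ≤ 𝓛⁻¹⁵`, `𝐚₁₅ = χϰ₁₃`, `j = 1, 2, 3`:
`‖S_j(𝐚₁₅,𝐚₂₂)|_{P″₁<dr<P₂} − main12u049intEx_j‖ ≤ εα` (twin of `top1522Ex_of_eval` at `sjOn_top_a15_sub_sumEx_pow15`).
[cite: Zhang2022LandauSiegel, §12 (12.16) p.73] -/
theorem top1522Ex_pow15 :
    ∀ ε : ℝ, 0 < ε → ForAllLarge fun D _ χ => ‖χ.LFunction 1‖ ≤ 1 / Real.log D ^ 15 →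
      ∀ a15 : ℕ → ℂ, (∀ n, a15 n = χ (n : ZMod D) * vk13 D n) →
        ∀ j ∈ ({1, 2, 3} : Finset ℕ),
          ‖SjOn c' D j a15 (a22 χ) (rngTop D) - main12u049intEx c' χ j‖ ≤ ε * alpha D := by
  intro ε hε
  have hε2 : 0 < ε / 2 := by positivity
  refine ((sjOn_top_a15_sub_sumEx_pow15 c' (ε / 2) hε2).and (main12u049sumEx_sub_intEx c' (ε / 2) hε2)).mono ?_
  intro D _ χ _ _ ⟨hE, hI⟩ hA a15 ha15 j hj
  have h1 := hE hA a15 ha15 j hj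
  have h2 := hI j hj
  calc ‖SjOn c' D j a15 (a22 χ) (rngTop D) - main12u049intEx c' χ j‖
      = ‖(SjOn c' D j a15 (a22 χ) (rngTop D) - main12u049sumEx c' χ j) +
          (main12u049sumEx c' χ j - main12u049intEx c' χ j)‖ := by congr 1; ring
    _ ≤ ‖SjOn c' D j a15 (a22 χ) (rngTop D) - main12u049sumEx c' χ j‖ +
          ‖main12u049sumEx c' χ j - main12u049intEx c' χ j‖ := norm_add_le _ _
    _ ≤ ε / 2 * alpha D + ε / 2 * alpha D := add_le_add h1 h2
    _ = ε * alpha D := by ring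

/-- **Node `Top1522Ex` under `Repair.Bed.AssumptionAWith E`, every real `E ≥ 15`, UNCONDITIONAL** (transfer per `ε`; at the
printed `E = 2022` the body of `Top1522Ex c′`, i.e. of the tree theorem `top1522Ex_holds`, not restated).
[cite: Zhang2022LandauSiegel, §12 (12.16) p.73] -/
theorem top1522Ex_of_assumptionAWith {E : ℝ} (hE : 15 ≤ E) :
    ∀ ε : ℝ, 0 < ε → ForAllLarge fun D _ χ => AssumptionAWith E D χ →
      ∀ a15 : ℕ → ℂ, (∀ n, a15 n = χ (n : ZMod D) * vk13 D n) →
        ∀ j ∈ ({1, 2, 3} : Finset ℕ),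
          ‖SjOn c' D j a15 (a22 χ) (rngTop D) - main12u049intEx c' χ j‖ ≤ ε * alpha D := by
  intro ε hε
  exact Repair.Gap.forAllLarge_assumptionAWith_of_pow15 hE (top1522Ex_pow15 c' ε hε)

end Literature.NumberTheory.LFunctions.Zhang2022.Typed.Sec12C

end
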